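import Literature.NumberTheory.ModularForms.CohenEisensteinCoefficients
import Literature.NumberTheory.EllipticCurves.GaussSumJacobiChar
import Literature.NumberTheory.LFunctions.DirichletLValueBernoulli
import HarnessLib

/-!
# Cohen's `h(r, N)`: the value `L(1 − r, χ_D) = −B_{r,χ_D}/r` through the convergent series `L(r, χ_D)`
# (`= (−1)^{[r/2]} (r−1)! |D|^{r−1/2} 2^{1−r} π^{−r} L(r, χ_D)`, odd fundamental `D`)

Topic `Literature/NumberTheory/ModularForms` (sub-namespace `CohenEisenstein`). THEOREMS ONLY (no definition, no named fact).

H. Cohen [Cohen1975, §2] introduces, for `r ≥ 1` and `N ≥ 1` with `(−1)^r N = D f²`,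
`h(r, N) := (−1)^{[r/2]} (r−1)! N^{r−1/2} 2^{1−r} π^{−r} L(r, χ_{(−1)^r N})`, and the point of the definition of his numbers
`H(r, N)` (the tree's `CohenEisenstein.cohenH`, file `CohenEisensteinCoefficients`) is that for FUNDAMENTAL `D = (−1)^r N` this is the
rational number `L(1 − r, χ_D) = −B_{r,χ_D}/r` — the functional equation of `L(s, χ_D)` at the integer `r` together with Gauss's
evaluation of `τ(χ_D) = √D`. This file PROVES that identity in the tree's currency, for ODD fundamental discriminants
`D ≡ 1 (mod 4)` (`|D|` odd square-free) and `r ≥ 2` of the parity `χ_D(−1) = (−1)^r`: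

  **`algebraMap ℚ ℂ (lValueDisc r D) = (−1)^{⌊r/2⌋} · (r−1)!/2^{r−1} · |D|^{r−1} · √|D| · π^{−r} · L(r, χ_D)`**

(`algebraMap_lValueDisc_eq_LFunction_jacobiChar`), where `χ_D` is the tree's Jacobi character `QuadraticFields.jacobiChar |D|`
(`= (·/|D|) = χ_D` for `D ≡ 1 (mod 4)`, Montgomery–Vaughan Thm. 9.13) and `L(r, χ_D)` is Mathlib's `DirichletCharacter.LFunction`
(`= Σ χ_D(n) n^{−r}` for `r ≥ 2`). INGREDIENTS, all in the tree: `LFunctions.LFunction_eq_bernoulli`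
(`L(r, ψ) = −(2πi)^r B_{r,ψ̄}/(2·r!·N^{r−1}·W(ψ̄))`, primitive `ψ`, Apostol Thm. 12.19), Gauss's theorem WITH SIGN
`W(χ_D) = √|D|` resp. `i√|D|` (`EllipticCurves.ModularForms.gaussSum_jacobiChar_of_mod_four_eq_one/_three`, from the theta multiplier),
`isPrimitive_jacobiChar`, `isQuadratic_jacobiChar`, and the bridge `CohenEisenstein.algebraMap_lValueDisc`. Use: this is ingredient (C) of
the constant-term computation for the `m`-cut Cohen–Eisenstein series (crux `PrintCFram.BottomClassIndexLawFiveLe`, cell `bsd-print-cfram`,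
crux notes `…-w5g5-cusp-seed.md` §15): it turns the coefficients `cohenH r (|D'|f²) = lValueDisc r D' · cohenT` into
`u'_r π^{−r} |D'|^{r−1/2} L(r, χ_{D'}) · T`, whose family averages are computable. Even `D` (`4 ∣ D`) is NOT treated here.

References: [Cohen1975] §2 (definition of `h(r, N)`, `H(r, N)`); [Washington1997] Thm. 4.2; [MontgomeryVaughan2007] Thm. 9.17;
[Apostol1976] Thm. 12.19.
-/

noncomputable section

open Complex
open scoped NumberTheorySymbols

namespace Literature.NumberTheory.ModularForms.CohenEisenstein

open Literature.NumberTheory.QuadraticFields Literature.NumberTheory.LFunctions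
open Literature.NumberTheory.EllipticCurves.ModularForms

/-- For an odd square-free `q ≡ 1 (mod 4)` the Jacobi character is even: `(−1/q) = 1`. [cite: Cox2013, §1.C Lemma 1.14] -/
theorem jacobiChar_neg_one_of_mod_four_eq_one {q : ℕ} [NeZero q] (hq : q % 4 = 1) : jacobiChar q (-1) = 1 := by
  have hodd : Odd q := Nat.odd_iff.mpr (by omega)
  have h := jacobiChar_intCast (q := q) (-1)
  rw [Int.cast_neg, Int.cast_one] at h
  rw [h, jacobiSym.at_neg_one hodd, ZMod.χ₄_nat_one_mod_four hq]
  norm_num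

/-- The Jacobi character of `|D|` has the values `χ_D` for `D ≡ 1 (mod 4)` (both are `(·/|D|)`). [cite: MontgomeryVaughan2007, §9.3, Thm. 9.13] -/
theorem jacobiChar_natAbs_eq_chiDisc {D : ℤ} [NeZero D.natAbs] (hD4 : D % 4 = 1) (c : ℕ) :
    jacobiChar D.natAbs (c : ZMod D.natAbs) = (chiDisc D c : ℂ) := by
  rw [jacobiChar_natCast, chiDisc_of_emod_four_eq_one hD4]

/-- **Cohen's `h(r, |D|)`: `L(1 − r, χ_D) = (−1)^{⌊r/2⌋} (r−1)! 2^{1−r} |D|^{r−1/2} π^{−r} L(r, χ_D)`** for an odd fundamental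
discriminant `D ≡ 1 (mod 4)` (`|D|` square-free) and `r ≥ 2` with `χ_D(−1) = (−1)^r` (i.e. `D > 0`, `r` even, or `D < 0`, `r` odd);
left side in the tree's rational currency `lValueDisc r D = −B_{r,χ_D}/r`, right side with Mathlib's `LFunction` of the Jacobi character
`(·/|D|)`. From `LFunction_eq_bernoulli` (Apostol 12.19) and Gauss's sign `τ(χ_D) = √D`. [cite: Cohen1975, §2 (definition of h(r,N) and of H(r,N))]
[cite: Washington1997, Thm. 4.2] [cite: MontgomeryVaughan2007, §9.3, Thm. 9.17] -/
theorem algebraMap_lValueDisc_eq_LFunction_jacobiChar {D : ℤ} [NeZero D.natAbs] (hD4 : D % 4 = 1)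
    (hsq : Squarefree D.natAbs) {r : ℕ} (hr : 2 ≤ r) (hpar : (0 < D ∧ Even r) ∨ (D < 0 ∧ Odd r)) :
    algebraMap ℚ ℂ (lValueDisc r D) =
      (-1 : ℂ) ^ (r / 2) * ((r - 1).factorial : ℂ) / 2 ^ (r - 1) * (D.natAbs : ℂ) ^ (r - 1) *
        (Real.sqrt D.natAbs : ℂ) / (Real.pi : ℂ) ^ r * (jacobiChar D.natAbs).LFunction r := by
  set n : ℕ := D.natAbs with hn
  have hn0 : n ≠ 0 := NeZero.ne n
  have hnD : (n : ℤ) = D ∨ (n : ℤ) = -D := by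
    rcases Int.natAbs_eq D with h | h
    · exact Or.inl h.symm
    · exact Or.inr (by omega)
  have hodd : Odd n := by
    rcases hnD with h | h <;> exact Nat.odd_iff.mpr (by omega)
  set ψ : DirichletCharacter ℂ n := jacobiChar n with hψ_def
  have hprim : ψ.IsPrimitive := isPrimitive_jacobiChar hodd hsq
  have hinv : ψ⁻¹ = ψ := (isQuadratic_jacobiChar (q := n)).inv
  have hψ : ∀ c : ℕ, ψ (c : ZMod n) = (chiDisc D c : ℂ) := fun c => jacobiChar_natAbs_eq_chiDisc hD4 c
  have hL := algebraMap_lValueDisc (R := ℂ) r ψ hψ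
  -- parity of ψ and the Gauss sum with its sign
  have hparψ : ψ (-1) = (-1) ^ r := by
    rcases hpar with ⟨hDpos, hev⟩ | ⟨hDneg, hod⟩
    · have h1 : n % 4 = 1 := by rcases hnD with h | h <;> omega
      rw [hev.neg_one_pow]
      exact jacobiChar_neg_one_of_mod_four_eq_one h1
    · have h3 : n % 4 = 3 := by rcases hnD with h | h <;> omega
      rw [hod.neg_one_pow]
      exact jacobiChar_neg_one_of_mod_four_eq_three h3
  have hB := LFunction_eq_bernoulli ψ hprim hr hparψ
  rw [hinv] at hB
  have hτ0 : gaussSum ψ (ZMod.stdAddChar (N := n)) ≠ 0 := by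
    have h := gaussSum_ne_zero ψ⁻¹ (isPrimitive_inv ψ hprim)
    rwa [hinv] at h
  have hπ : (Real.pi : ℂ) ≠ 0 := by exact_mod_cast Real.pi_ne_zero
  have h2πI : (2 * (Real.pi : ℂ) * I) ^ r ≠ 0 := pow_ne_zero _ (by simp [Real.pi_ne_zero, I_ne_zero])
  have hfac : ((r.factorial : ℕ) : ℂ) ≠ 0 := by exact_mod_cast r.factorial_ne_zero
  have hnC : (n : ℂ) ≠ 0 := by exact_mod_cast hn0
  have hrC : (r : ℂ) ≠ 0 := by exact_mod_cast (show r ≠ 0 by omega)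
  have hsqrt : (Real.sqrt n : ℂ) ≠ 0 := by
    exact_mod_cast (Real.sqrt_pos.mpr (by exact_mod_cast Nat.pos_of_ne_zero hn0)).ne'
  -- `B_{r,ψ}` in terms of `L(r,ψ)`
  have hBval : generalizedBernoulli r ψ =
      -(ψ.LFunction r * (2 * r.factorial * (n : ℂ) ^ (r - 1) * gaussSum ψ (ZMod.stdAddChar (N := n)))) /
        (2 * Real.pi * I) ^ r := by
    rw [hB]
    field_simp
  -- factorial and power bookkeeping
  have hfac' : (r.factorial : ℂ) = r * ((r - 1).factorial : ℂ) := by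
    rw [← Nat.mul_factorial_pred (by omega : r ≠ 0)]
    push_cast
    ring
  have h2pow : (2 : ℂ) ^ r = 2 * 2 ^ (r - 1) := by
    rw [← pow_succ', Nat.sub_add_cancel (by omega : 1 ≤ r)]
  have hI : (I : ℂ) ^ r ≠ 0 := pow_ne_zero _ I_ne_zero
  -- Gauss's sign, uniformly in the parity: `τ(χ_D) = (−1)^{⌊r/2⌋} √|D| · i^r`
  have hτI : gaussSum ψ (ZMod.stdAddChar (N := n)) = (-1 : ℂ) ^ (r / 2) * (Real.sqrt n : ℂ) * I ^ r := by
    rcases hpar with ⟨hDpos, ⟨j, hj⟩⟩ | ⟨hDneg, ⟨j, hj⟩⟩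
    · have h1 : n % 4 = 1 := by rcases hnD with h | h <;> omega
      have hdiv : r / 2 = j := by omega
      have hIr : I ^ r = (-1) ^ j := by rw [hj, ← two_mul, pow_mul, I_sq]
      rw [gaussSum_jacobiChar_of_mod_four_eq_one hsq h1, hdiv, hIr, mul_comm ((-1 : ℂ) ^ j) _, mul_assoc, ← mul_pow,
        neg_one_mul, neg_neg, one_pow, mul_one]
    · have h3 : n % 4 = 3 := by rcases hnD with h | h <;> omega
      have hdiv : r / 2 = j := by omega
      have hIr : I ^ r = (-1) ^ j * I := by rw [hj, pow_succ, pow_mul, I_sq]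
      rw [gaussSum_jacobiChar_of_mod_four_eq_three hsq h3, hdiv, hIr]
      have hm1 : ((-1 : ℂ) ^ j) * ((-1 : ℂ) ^ j) = 1 := by
        rw [← mul_pow, neg_one_mul, neg_neg, one_pow]
      linear_combination (-(I * (Real.sqrt n : ℂ))) * hm1
  rw [hL, hBval, hτI, mul_pow (2 * (Real.pi : ℂ)) I r, mul_pow (2 : ℂ) (Real.pi : ℂ) r, hfac', h2pow]
  field_simp
  ring

end Literature.NumberTheory.ModularForms.CohenEisenstein

end
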